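import Summits.ResolutionOfSingularities.ResolutionOfSingularities.Theorems.NearCutPrimeShedding
import Summits.ResolutionOfSingularities.ResolutionOfSingularities.Theorems.NearCutPortBridge
import HarnessLib

/-!
# NearCutResidual — decomp-res node «NearCut» (lens-3 g23, critic row 174): the residual modulo the PRINTED FACT

Composition of the two landed ends of the node: `Theorems/NearCutPrimeShedding.lean` decides the δ-balanced family
and re-locates the host aside `DefectWalksDeep` EXACTLY modulo the port `NearChainPort` ALONE
(`noBalancedTails_of_nearChainPort`, `defectWalksDeep_iff_of_nearChainPort`), and `Theorems/NearCutPortBridge.lean`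
identifies the port with the Literature NAMED FACT `CJS2020_nearChainStops_eTwo` (Cossart–Jannsen–Saito, LNM 2270,
Thm. 6.40 p. 104, `𝓑 = ∅`; = arXiv:0905.2191v2 Thm. 5.40).  Hence, modulo the PRINTED THEOREM as typed in
`Literature/`: the balanced-tail class holds, and `DefectWalksDeep` ⟺ free-point tails ∧ high-planar joint tails ∧
lossy strict tails (the three located, pairwise foreign residual classes).  Landing target:
`Summits/ResolutionOfSingularities/ResolutionOfSingularities/Theorems/NearCutResidual.lean`
(`--kind proof --supports stmt-ResolutionOfSingularities-31770`).
-/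

namespace Summit.ResolutionOfSingularities.ResolutionOfSingularities.Theorems.NearCut

open Literature.AlgebraicGeometry.Resolution
open Summit.ResolutionOfSingularities.ResolutionOfSingularities.Theses
open Summit.ResolutionOfSingularities.ResolutionOfSingularities.Theorems.ProximityCut (NoFreePointTailsDeep)
open Summit.ResolutionOfSingularities.ResolutionOfSingularities.Theorems.FreezeCut (NoHighPlanarJointTailsDeep)
open Summit.ResolutionOfSingularities.ResolutionOfSingularities.Theorems.WallCut (NoLossyStrictTailsDeep)

/-- **ALL δ-balanced tails are excluded modulo the PRINTED FACT** CJS 2020 Thm. 6.40 (`𝓑 = ∅`) as typed in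
`Literature/…/NearChainTerminationETwo.lean`. (Sources: CossartJannsenSaito2020, Thm. 6.40.) -/
theorem noBalancedTails_of_CJS2020 (h : CJS2020_nearChainStops_eTwo) : NoBalancedTailsDeep :=
  noBalancedTails_of_nearChainPort (nearChainPort_of_CJS2020 h)

/-- **EXACT RE-LOCATION OF THE HOST ASIDE 31770 MODULO THE PRINTED FACT ALONE**: given CJS 2020 Thm. 6.40
(`𝓑 = ∅`, Literature named fact `CJS2020_nearChainStops_eTwo`), `DefectWalksDeep` is EQUIVALENT to the conjunction
of the three located residual classes — free-point tails, high-planar joint tails, lossy strict tails.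
(Sources: CossartJannsenSaito2020, Thm. 6.40.) -/
theorem defectWalksDeep_iff_of_CJS2020 (h : CJS2020_nearChainStops_eTwo) :
    MaxContactCut.DefectWalksDeep ↔
      NoFreePointTailsDeep ∧ NoHighPlanarJointTailsDeep ∧ NoLossyStrictTailsDeep :=
  defectWalksDeep_iff_of_nearChainPort (nearChainPort_of_CJS2020 h)

end Summit.ResolutionOfSingularities.ResolutionOfSingularities.Theorems.NearCut
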